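import Summits.QuantumFields.BalabanUV.Beta.EriceRemainderEnclosureHistoryAutonomyComparisonAgeCompositionNestedTwoPairsNear

/-!
# EriceRemainderEnclosureHistoryAutonomyComparisonAgeCompositionTwoPairsBandsF — (E93i) route (N), first order: RATIONAL BANDS OF THE JOINT TWO-PAIR CERTIFICATE, NEAR REGIME (ratio below 2), PART F.
# Instances of (E93c) `flow_nonneg_census_three_ages_two_pairs_near` for bands `K_lo ≤ k₂ ≤ K_hi`, `K3_lo ≤ k₃ ≤ K3_hi` inside `57 ≤ k₃ ≤ 2k₂+1`
# (`28 ≤ k₂ ≤ 44`): worst-case rational parameters `s = 0.70715`, `σ₁`, `σ₂` (from `p₂⁴(K3_hi+1) ≤ K_lo+1`), `E = 2(K_hi+1)∕K3_lo ≥ 1`, `B = 4∕K_lo`,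
# `C = 4∕K3_lo`, and exact rational certificate data with the CONVEX middle residual flattened at its vertex (generator
# `HOME/b2b-balaban-beta-d4-p2/g83/numerics/band_lean.py`, `band_near.py`).  THE END `0 ≤ ε ≤ e` along every admissible flow, every horizon, every
# damping of the self-consistent class, for every `(k₂, k₃)` of the band

Cell `pub-balaban`, β-function sub-cell, BINDER row D4 «RemainderConst leaves for Bałaban's split» (`HOME/BINDER-OWNERS.md`; owner lineage `b2b-balaban-beta-an4`;
this file by co-owner #2 lineage `b2b-balaban-beta-d4-p2`, generation 83), β-FLOW TEAM duty (1), FREEZE (0) honoured (def-free; nothing restated).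

HONEST FRAMING (page 1, verbatim and binding).  *"Discharging BetaPertH makes Bałaban's UV stability UNCONDITIONAL — a real constructive-QFT result; it is
NOT the continuum limit and NOT the Clay problem."*  THIS FILE DISCHARGES NOTHING OF THE KIND.  Elementary real algebra ∕ real analysis about ABSTRACT
functionals on a box ]0,γ]^ℕ with displayed floors, profiles and signs, and the FIRST-ORDER renewal objects of route (N) built from them — hypotheses of a
census, not facts; the form, signs, ages and moments of Bałaban's (1.22) limit functional are NOT PRINTED ([I] p. 298; GAPS G-t4-U2-1∕-2) and NOT asserted.
Row D4 class UNCHANGED (critical-path width 0; instance 0∕1; D4 DISCHARGE NO DATE); NOT B12 Thm 2, NOT BetaPertH, NOT continuum, NOT Clay.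

WHAT IS PROVED ([folklore]; 0 `def`, 0 sorry).  `joint_near_band_k28_29_57_59`, `joint_near_band_k30_31_57_63`, `joint_near_band_k32_33_57_67`, `joint_near_band_k34_35_57_71`, `joint_near_band_k36_37_57_75`, `joint_near_band_k38_39_57_79`.
-/
noncomputable section
open Finset

namespace Summit.QuantumFields.BalabanUV.Beta.EriceRemainderEnclosureHistoryAutonomyComparisonAgeCompositionTwoPairsBandsF

open Literature.MathematicalPhysics.QuantumFieldTheory.Balaban1983to89
open Literature.MathematicalPhysics.QuantumFieldTheory.Balaban1983to89.T4BetaStationary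
open Literature.MathematicalPhysics.QuantumFieldTheory.Balaban1983to89.T4BetaFlowWellPosed
open Summit.QuantumFields.BalabanUV.Beta.EriceRemainderEnclosureHistoryAutonomyComparisonAgeCompositionNestedTwoPairsNear (flow_nonneg_census_three_ages_two_pairs_near)

variable {B : (ℕ → ℝ) → ℝ} {γ b gIR : ℝ} {L : ℕ → ℝ} {K : ℕ} {h g : ℕ → ℝ}

/-- **NEAR BAND `28 ≤ k₂ ≤ 29`, `57 ≤ k₃ ≤ 59` (ratio below 2) ⟹ THE END** ((E93c) `flow_nonneg_census_three_ages_two_pairs_near` with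
`s = 14143/20000`, `p₁ = 5081/10000`, `σ₁ = 4689/5000`, `p₂ = 8337/10000`, `σ₂ = 9641/12500`, `E = 20/19`, `B = 1/7`, `C = 4/57`; exact rational certificate, margin `0.0146`). [folklore] -/
theorem joint_near_band_k28_29_57_59 (hmono : ∀ u v : ℕ → ℝ, SeqBox γ u → SeqBox γ v → (∀ j, u j ≤ v j) → B u ≤ B v)
    (hL : ∀ k, 0 ≤ L k) (hb : 0 < b) (hlo : ∀ u, SeqBox γ u → b ≤ B u) (hdom : ∀ u, SeqBox γ u → ∑ k ∈ range K, L k * u k ≤ B u)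
    (hh : SeqBox γ h) (hf : MemFlow B gIR h) (hg : ∀ t, 0 < g t ∧ g t ≤ 1)
    (hgF : ∀ t, 1 ≤ g t * (1 + ∑ k ∈ range K, L k * h (t + k) ^ 3 / 2))
    {k₂ k₃ : ℕ} (hk2lo : 28 ≤ k₂) (hk2hi : k₂ ≤ 29) (hk3lo : 57 ≤ k₃) (hk3hi : k₃ ≤ 59) (hk3K : k₃ < K)
    (hL3 : ∀ j, j < K → j ≠ 1 → j ≠ k₂ → j ≠ k₃ → L j = 0)
    {N : ℕ} {KL : ℕ → ℕ → ℕ → ℝ}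
    (hKL : ∀ k n l, KL k n l = if 0 < k ∧ k < K ∧ l < k then L k * h (n + k) ^ 3 / 2 * ∏ t ∈ Ico (n + 1 + l) (n + k + 1), g t else 0)
    {KA : ℕ → ℕ → ℕ → ℝ} {RA : ℕ → (ℕ → ℝ) → ℕ → ℝ}
    (hRA : ∀ i v m, RA i v m = ∑ l ∈ range K, KA i m l * v (m + 1 + l))
    (hKA : ∀ i m l, KA i m l = KL i m l + KA (i + 1) m l) (hKAtop : ∀ m l, KA K m l = 0)
    {e ε : ℕ → ℝ} (he0 : ∀ m, 0 ≤ e m) (hea : ∀ m, e (m + 1) ≤ e m)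
    (hεt : ∀ m, N < m → ε m = 0) (hεrec : ∀ m, ε m = e m - RA 1 ε m) : ∀ m, 0 ≤ ε m ∧ ε m ≤ e m := by
  have hs99 : Real.sqrt 2 ≤ 99 / 70 := Real.sqrt_le_iff.mpr ⟨by norm_num, by norm_num⟩
  have hk2lo' : (28 : ℝ) ≤ k₂ := by exact_mod_cast hk2lo
  have hk2hi' : (k₂ : ℝ) ≤ 29 := by exact_mod_cast hk2hi
  have hk3lo' : (57 : ℝ) ≤ k₃ := by exact_mod_cast hk3lo
  have hk3hi' : (k₃ : ℝ) ≤ 59 := by exact_mod_cast hk3hi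
  have hk3pos : (0 : ℝ) < k₃ := by exact_mod_cast (show 0 < k₃ by omega)
  refine flow_nonneg_census_three_ages_two_pairs_near hmono hL hb hlo hdom hh hf hg hgF (by omega) (by omega) hk3K hL3
    (p₁ := ((5081 : ℝ) / 10000)) (p₂ := ((8337 : ℝ) / 10000)) (by norm_num) ?_ (by norm_num) ?_
    (s := ((14143 : ℝ) / 20000)) (σ₁ := ((4689 : ℝ) / 5000)) (σ₂ := ((9641 : ℝ) / 12500)) (E := ((20 : ℝ) / 19)) (Bc := ((4 : ℝ) / 28)) (Cc := ((4 : ℝ) / 57))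
    (by linarith [hs99]) (by norm_num) ?_ ?_ ?_ (by norm_num) ?_ ?_ (by norm_num)
    (b₁ := ((6413 : ℝ) / 100000)) (a₂ := ((4613 : ℝ) / 20000)) (ρ₁ := ((8600660941 : ℝ) / 38000000000)) (ρ₂ := ((8600660941 : ℝ) / 38000000000)) (ρ₃ := ((2623101119 : ℝ) / 11875000000)) (ρ₄ := ((2623101119 : ℝ) / 11875000000))
    (Or.inr (by norm_num)) (by norm_num) (by norm_num) (by norm_num)
    (fun h => absurd h (by norm_num)) (fun h => absurd h (by norm_num)) (fun h => absurd h (by norm_num)) (fun h => absurd h (by norm_num))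
    (fun _ => by norm_num) (fun _ => by norm_num) (fun _ => by norm_num)
    (Or.inl (by norm_num)) (by norm_num) (by norm_num) (by norm_num) (by norm_num)
    hKL hRA hKA hKAtop he0 hea hεt hεrec
  · -- p₁⁴(k₂+1) ≤ 2
    have h1 : ((5081 : ℝ) / 10000) ^ 4 * ((k₂ : ℝ) + 1) ≤ ((5081 : ℝ) / 10000) ^ 4 * ((29 : ℝ) + 1) := mul_le_mul_of_nonneg_left (by linarith) (by positivity)
    have h2 : ((5081 : ℝ) / 10000) ^ 4 * ((29 : ℝ) + 1) ≤ 2 := by norm_num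
    linarith
  · -- p₂⁴(k₃+1) ≤ k₂+1
    have h1 : ((8337 : ℝ) / 10000) ^ 4 * ((k₃ : ℝ) + 1) ≤ ((8337 : ℝ) / 10000) ^ 4 * ((59 : ℝ) + 1) := mul_le_mul_of_nonneg_left (by linarith) (by positivity)
    have h2 : ((8337 : ℝ) / 10000) ^ 4 * ((59 : ℝ) + 1) ≤ (28 : ℝ) + 1 := by norm_num
    linarith
  · -- √2∕(1+p₁) ≤ σ₁
    rw [div_le_iff₀ (by norm_num)]; linarith [hs99]
  · -- √2∕(1+p₂) ≤ σ₂
    rw [div_le_iff₀ (by norm_num)]; linarith [hs99]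
  · -- 2(k₂+1)∕k₃ ≤ E
    rw [div_le_iff₀ hk3pos]; nlinarith [hk2hi', hk3lo']
  · -- 4∕k₂ ≤ B
    exact div_le_div_of_nonneg_left (by norm_num) (by norm_num) hk2lo'
  · -- 4∕k₃ ≤ C
    exact div_le_div_of_nonneg_left (by norm_num) (by norm_num) hk3lo'

/-- **NEAR BAND `30 ≤ k₂ ≤ 31`, `57 ≤ k₃ ≤ 63` (ratio below 2) ⟹ THE END** ((E93c) `flow_nonneg_census_three_ages_two_pairs_near` with
`s = 14143/20000`, `p₁ = 1/2`, `σ₁ = 47143/50000`, `p₂ = 4171/5000`, `σ₂ = 77107/100000`, `E = 64/57`, `B = 2/15`, `C = 4/57`; exact rational certificate, margin `0.0129`). [folklore] -/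
theorem joint_near_band_k30_31_57_63 (hmono : ∀ u v : ℕ → ℝ, SeqBox γ u → SeqBox γ v → (∀ j, u j ≤ v j) → B u ≤ B v)
    (hL : ∀ k, 0 ≤ L k) (hb : 0 < b) (hlo : ∀ u, SeqBox γ u → b ≤ B u) (hdom : ∀ u, SeqBox γ u → ∑ k ∈ range K, L k * u k ≤ B u)
    (hh : SeqBox γ h) (hf : MemFlow B gIR h) (hg : ∀ t, 0 < g t ∧ g t ≤ 1)
    (hgF : ∀ t, 1 ≤ g t * (1 + ∑ k ∈ range K, L k * h (t + k) ^ 3 / 2))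
    {k₂ k₃ : ℕ} (hk2lo : 30 ≤ k₂) (hk2hi : k₂ ≤ 31) (hk3lo : 57 ≤ k₃) (hk3hi : k₃ ≤ 63) (hk3K : k₃ < K)
    (hL3 : ∀ j, j < K → j ≠ 1 → j ≠ k₂ → j ≠ k₃ → L j = 0)
    {N : ℕ} {KL : ℕ → ℕ → ℕ → ℝ}
    (hKL : ∀ k n l, KL k n l = if 0 < k ∧ k < K ∧ l < k then L k * h (n + k) ^ 3 / 2 * ∏ t ∈ Ico (n + 1 + l) (n + k + 1), g t else 0)
    {KA : ℕ → ℕ → ℕ → ℝ} {RA : ℕ → (ℕ → ℝ) → ℕ → ℝ}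
    (hRA : ∀ i v m, RA i v m = ∑ l ∈ range K, KA i m l * v (m + 1 + l))
    (hKA : ∀ i m l, KA i m l = KL i m l + KA (i + 1) m l) (hKAtop : ∀ m l, KA K m l = 0)
    {e ε : ℕ → ℝ} (he0 : ∀ m, 0 ≤ e m) (hea : ∀ m, e (m + 1) ≤ e m)
    (hεt : ∀ m, N < m → ε m = 0) (hεrec : ∀ m, ε m = e m - RA 1 ε m) : ∀ m, 0 ≤ ε m ∧ ε m ≤ e m := by
  have hs99 : Real.sqrt 2 ≤ 99 / 70 := Real.sqrt_le_iff.mpr ⟨by norm_num, by norm_num⟩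
  have hk2lo' : (30 : ℝ) ≤ k₂ := by exact_mod_cast hk2lo
  have hk2hi' : (k₂ : ℝ) ≤ 31 := by exact_mod_cast hk2hi
  have hk3lo' : (57 : ℝ) ≤ k₃ := by exact_mod_cast hk3lo
  have hk3hi' : (k₃ : ℝ) ≤ 63 := by exact_mod_cast hk3hi
  have hk3pos : (0 : ℝ) < k₃ := by exact_mod_cast (show 0 < k₃ by omega)
  refine flow_nonneg_census_three_ages_two_pairs_near hmono hL hb hlo hdom hh hf hg hgF (by omega) (by omega) hk3K hL3
    (p₁ := ((1 : ℝ) / 2)) (p₂ := ((4171 : ℝ) / 5000)) (by norm_num) ?_ (by norm_num) ?_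
    (s := ((14143 : ℝ) / 20000)) (σ₁ := ((47143 : ℝ) / 50000)) (σ₂ := ((77107 : ℝ) / 100000)) (E := ((64 : ℝ) / 57)) (Bc := ((4 : ℝ) / 30)) (Cc := ((4 : ℝ) / 57))
    (by linarith [hs99]) (by norm_num) ?_ ?_ ?_ (by norm_num) ?_ ?_ (by norm_num)
    (b₁ := ((799 : ℝ) / 12500)) (a₂ := ((23571 : ℝ) / 100000)) (ρ₁ := ((3183150701 : ℝ) / 14250000000)) (ρ₂ := ((3183150701 : ℝ) / 14250000000)) (ρ₃ := ((480341973857 : ℝ) / 2280000000000)) (ρ₄ := ((480341973857 : ℝ) / 2280000000000))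
    (Or.inr (by norm_num)) (by norm_num) (by norm_num) (by norm_num)
    (fun h => absurd h (by norm_num)) (fun h => absurd h (by norm_num)) (fun h => absurd h (by norm_num)) (fun h => absurd h (by norm_num))
    (fun _ => by norm_num) (fun _ => by norm_num) (fun _ => by norm_num)
    (Or.inl (by norm_num)) (by norm_num) (by norm_num) (by norm_num) (by norm_num)
    hKL hRA hKA hKAtop he0 hea hεt hεrec
  · -- p₁⁴(k₂+1) ≤ 2
    have h1 : ((1 : ℝ) / 2) ^ 4 * ((k₂ : ℝ) + 1) ≤ ((1 : ℝ) / 2) ^ 4 * ((31 : ℝ) + 1) := mul_le_mul_of_nonneg_left (by linarith) (by positivity)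
    have h2 : ((1 : ℝ) / 2) ^ 4 * ((31 : ℝ) + 1) ≤ 2 := by norm_num
    linarith
  · -- p₂⁴(k₃+1) ≤ k₂+1
    have h1 : ((4171 : ℝ) / 5000) ^ 4 * ((k₃ : ℝ) + 1) ≤ ((4171 : ℝ) / 5000) ^ 4 * ((63 : ℝ) + 1) := mul_le_mul_of_nonneg_left (by linarith) (by positivity)
    have h2 : ((4171 : ℝ) / 5000) ^ 4 * ((63 : ℝ) + 1) ≤ (30 : ℝ) + 1 := by norm_num
    linarith
  · -- √2∕(1+p₁) ≤ σ₁
    rw [div_le_iff₀ (by norm_num)]; linarith [hs99]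
  · -- √2∕(1+p₂) ≤ σ₂
    rw [div_le_iff₀ (by norm_num)]; linarith [hs99]
  · -- 2(k₂+1)∕k₃ ≤ E
    rw [div_le_iff₀ hk3pos]; nlinarith [hk2hi', hk3lo']
  · -- 4∕k₂ ≤ B
    exact div_le_div_of_nonneg_left (by norm_num) (by norm_num) hk2lo'
  · -- 4∕k₃ ≤ C
    exact div_le_div_of_nonneg_left (by norm_num) (by norm_num) hk3lo'

/-- **NEAR BAND `32 ≤ k₂ ≤ 33`, `57 ≤ k₃ ≤ 67` (ratio below 2) ⟹ THE END** ((E93c) `flow_nonneg_census_three_ages_two_pairs_near` with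
`s = 14143/20000`, `p₁ = 1231/2500`, `σ₁ = 47383/50000`, `p₂ = 4173/5000`, `σ₂ = 7709/10000`, `E = 68/57`, `B = 1/8`, `C = 4/57`; exact rational certificate, margin `0.0111`). [folklore] -/
theorem joint_near_band_k32_33_57_67 (hmono : ∀ u v : ℕ → ℝ, SeqBox γ u → SeqBox γ v → (∀ j, u j ≤ v j) → B u ≤ B v)
    (hL : ∀ k, 0 ≤ L k) (hb : 0 < b) (hlo : ∀ u, SeqBox γ u → b ≤ B u) (hdom : ∀ u, SeqBox γ u → ∑ k ∈ range K, L k * u k ≤ B u)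
    (hh : SeqBox γ h) (hf : MemFlow B gIR h) (hg : ∀ t, 0 < g t ∧ g t ≤ 1)
    (hgF : ∀ t, 1 ≤ g t * (1 + ∑ k ∈ range K, L k * h (t + k) ^ 3 / 2))
    {k₂ k₃ : ℕ} (hk2lo : 32 ≤ k₂) (hk2hi : k₂ ≤ 33) (hk3lo : 57 ≤ k₃) (hk3hi : k₃ ≤ 67) (hk3K : k₃ < K)
    (hL3 : ∀ j, j < K → j ≠ 1 → j ≠ k₂ → j ≠ k₃ → L j = 0)
    {N : ℕ} {KL : ℕ → ℕ → ℕ → ℝ}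
    (hKL : ∀ k n l, KL k n l = if 0 < k ∧ k < K ∧ l < k then L k * h (n + k) ^ 3 / 2 * ∏ t ∈ Ico (n + 1 + l) (n + k + 1), g t else 0)
    {KA : ℕ → ℕ → ℕ → ℝ} {RA : ℕ → (ℕ → ℝ) → ℕ → ℝ}
    (hRA : ∀ i v m, RA i v m = ∑ l ∈ range K, KA i m l * v (m + 1 + l))
    (hKA : ∀ i m l, KA i m l = KL i m l + KA (i + 1) m l) (hKAtop : ∀ m l, KA K m l = 0)
    {e ε : ℕ → ℝ} (he0 : ∀ m, 0 ≤ e m) (hea : ∀ m, e (m + 1) ≤ e m)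
    (hεt : ∀ m, N < m → ε m = 0) (hεrec : ∀ m, ε m = e m - RA 1 ε m) : ∀ m, 0 ≤ ε m ∧ ε m ≤ e m := by
  have hs99 : Real.sqrt 2 ≤ 99 / 70 := Real.sqrt_le_iff.mpr ⟨by norm_num, by norm_num⟩
  have hk2lo' : (32 : ℝ) ≤ k₂ := by exact_mod_cast hk2lo
  have hk2hi' : (k₂ : ℝ) ≤ 33 := by exact_mod_cast hk2hi
  have hk3lo' : (57 : ℝ) ≤ k₃ := by exact_mod_cast hk3lo
  have hk3hi' : (k₃ : ℝ) ≤ 67 := by exact_mod_cast hk3hi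
  have hk3pos : (0 : ℝ) < k₃ := by exact_mod_cast (show 0 < k₃ by omega)
  refine flow_nonneg_census_three_ages_two_pairs_near hmono hL hb hlo hdom hh hf hg hgF (by omega) (by omega) hk3K hL3
    (p₁ := ((1231 : ℝ) / 2500)) (p₂ := ((4173 : ℝ) / 5000)) (by norm_num) ?_ (by norm_num) ?_
    (s := ((14143 : ℝ) / 20000)) (σ₁ := ((47383 : ℝ) / 50000)) (σ₂ := ((7709 : ℝ) / 10000)) (E := ((68 : ℝ) / 57)) (Bc := ((4 : ℝ) / 32)) (Cc := ((4 : ℝ) / 57))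
    (by linarith [hs99]) (by norm_num) ?_ ?_ ?_ (by norm_num) ?_ ?_ (by norm_num)
    (b₁ := ((51 : ℝ) / 800)) (a₂ := ((24051 : ℝ) / 100000)) (ρ₁ := ((67001659 : ℝ) / 304000000)) (ρ₂ := ((67001659 : ℝ) / 304000000)) (ρ₃ := ((4569764509 : ℝ) / 22800000000)) (ρ₄ := ((4569764509 : ℝ) / 22800000000))
    (Or.inr (by norm_num)) (by norm_num) (by norm_num) (by norm_num)
    (fun h => absurd h (by norm_num)) (fun h => absurd h (by norm_num)) (fun h => absurd h (by norm_num)) (fun h => absurd h (by norm_num))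
    (fun _ => by norm_num) (fun _ => by norm_num) (fun _ => by norm_num)
    (Or.inl (by norm_num)) (by norm_num) (by norm_num) (by norm_num) (by norm_num)
    hKL hRA hKA hKAtop he0 hea hεt hεrec
  · -- p₁⁴(k₂+1) ≤ 2
    have h1 : ((1231 : ℝ) / 2500) ^ 4 * ((k₂ : ℝ) + 1) ≤ ((1231 : ℝ) / 2500) ^ 4 * ((33 : ℝ) + 1) := mul_le_mul_of_nonneg_left (by linarith) (by positivity)
    have h2 : ((1231 : ℝ) / 2500) ^ 4 * ((33 : ℝ) + 1) ≤ 2 := by norm_num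
    linarith
  · -- p₂⁴(k₃+1) ≤ k₂+1
    have h1 : ((4173 : ℝ) / 5000) ^ 4 * ((k₃ : ℝ) + 1) ≤ ((4173 : ℝ) / 5000) ^ 4 * ((67 : ℝ) + 1) := mul_le_mul_of_nonneg_left (by linarith) (by positivity)
    have h2 : ((4173 : ℝ) / 5000) ^ 4 * ((67 : ℝ) + 1) ≤ (32 : ℝ) + 1 := by norm_num
    linarith
  · -- √2∕(1+p₁) ≤ σ₁
    rw [div_le_iff₀ (by norm_num)]; linarith [hs99]
  · -- √2∕(1+p₂) ≤ σ₂
    rw [div_le_iff₀ (by norm_num)]; linarith [hs99]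
  · -- 2(k₂+1)∕k₃ ≤ E
    rw [div_le_iff₀ hk3pos]; nlinarith [hk2hi', hk3lo']
  · -- 4∕k₂ ≤ B
    exact div_le_div_of_nonneg_left (by norm_num) (by norm_num) hk2lo'
  · -- 4∕k₃ ≤ C
    exact div_le_div_of_nonneg_left (by norm_num) (by norm_num) hk3lo'

/-- **NEAR BAND `34 ≤ k₂ ≤ 35`, `57 ≤ k₃ ≤ 71` (ratio below 2) ⟹ THE END** ((E93c) `flow_nonneg_census_three_ages_two_pairs_near` with
`s = 14143/20000`, `p₁ = 2427/5000`, `σ₁ = 95213/100000`, `p₂ = 8349/10000`, `σ₂ = 77077/100000`, `E = 24/19`, `B = 2/17`, `C = 4/57`; exact rational certificate, margin `0.0092`). [folklore] -/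
theorem joint_near_band_k34_35_57_71 (hmono : ∀ u v : ℕ → ℝ, SeqBox γ u → SeqBox γ v → (∀ j, u j ≤ v j) → B u ≤ B v)
    (hL : ∀ k, 0 ≤ L k) (hb : 0 < b) (hlo : ∀ u, SeqBox γ u → b ≤ B u) (hdom : ∀ u, SeqBox γ u → ∑ k ∈ range K, L k * u k ≤ B u)
    (hh : SeqBox γ h) (hf : MemFlow B gIR h) (hg : ∀ t, 0 < g t ∧ g t ≤ 1)
    (hgF : ∀ t, 1 ≤ g t * (1 + ∑ k ∈ range K, L k * h (t + k) ^ 3 / 2))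
    {k₂ k₃ : ℕ} (hk2lo : 34 ≤ k₂) (hk2hi : k₂ ≤ 35) (hk3lo : 57 ≤ k₃) (hk3hi : k₃ ≤ 71) (hk3K : k₃ < K)
    (hL3 : ∀ j, j < K → j ≠ 1 → j ≠ k₂ → j ≠ k₃ → L j = 0)
    {N : ℕ} {KL : ℕ → ℕ → ℕ → ℝ}
    (hKL : ∀ k n l, KL k n l = if 0 < k ∧ k < K ∧ l < k then L k * h (n + k) ^ 3 / 2 * ∏ t ∈ Ico (n + 1 + l) (n + k + 1), g t else 0)
    {KA : ℕ → ℕ → ℕ → ℝ} {RA : ℕ → (ℕ → ℝ) → ℕ → ℝ}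
    (hRA : ∀ i v m, RA i v m = ∑ l ∈ range K, KA i m l * v (m + 1 + l))
    (hKA : ∀ i m l, KA i m l = KL i m l + KA (i + 1) m l) (hKAtop : ∀ m l, KA K m l = 0)
    {e ε : ℕ → ℝ} (he0 : ∀ m, 0 ≤ e m) (hea : ∀ m, e (m + 1) ≤ e m)
    (hεt : ∀ m, N < m → ε m = 0) (hεrec : ∀ m, ε m = e m - RA 1 ε m) : ∀ m, 0 ≤ ε m ∧ ε m ≤ e m := by
  have hs99 : Real.sqrt 2 ≤ 99 / 70 := Real.sqrt_le_iff.mpr ⟨by norm_num, by norm_num⟩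
  have hk2lo' : (34 : ℝ) ≤ k₂ := by exact_mod_cast hk2lo
  have hk2hi' : (k₂ : ℝ) ≤ 35 := by exact_mod_cast hk2hi
  have hk3lo' : (57 : ℝ) ≤ k₃ := by exact_mod_cast hk3lo
  have hk3hi' : (k₃ : ℝ) ≤ 71 := by exact_mod_cast hk3hi
  have hk3pos : (0 : ℝ) < k₃ := by exact_mod_cast (show 0 < k₃ by omega)
  refine flow_nonneg_census_three_ages_two_pairs_near hmono hL hb hlo hdom hh hf hg hgF (by omega) (by omega) hk3K hL3
    (p₁ := ((2427 : ℝ) / 5000)) (p₂ := ((8349 : ℝ) / 10000)) (by norm_num) ?_ (by norm_num) ?_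
    (s := ((14143 : ℝ) / 20000)) (σ₁ := ((95213 : ℝ) / 100000)) (σ₂ := ((77077 : ℝ) / 100000)) (E := ((24 : ℝ) / 19)) (Bc := ((4 : ℝ) / 34)) (Cc := ((4 : ℝ) / 57))
    (by linarith [hs99]) (by norm_num) ?_ ?_ ?_ (by norm_num) ?_ ?_ (by norm_num)
    (b₁ := ((3181 : ℝ) / 50000)) (a₂ := ((12249 : ℝ) / 50000)) (ρ₁ := ((826085117 : ℝ) / 3800000000)) (ρ₂ := ((826085117 : ℝ) / 3800000000)) (ρ₃ := ((28902096071 : ℝ) / 152000000000)) (ρ₄ := ((28902096071 : ℝ) / 152000000000))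
    (Or.inr (by norm_num)) (by norm_num) (by norm_num) (by norm_num)
    (fun h => absurd h (by norm_num)) (fun h => absurd h (by norm_num)) (fun h => absurd h (by norm_num)) (fun h => absurd h (by norm_num))
    (fun _ => by norm_num) (fun _ => by norm_num) (fun _ => by norm_num)
    (Or.inl (by norm_num)) (by norm_num) (by norm_num) (by norm_num) (by norm_num)
    hKL hRA hKA hKAtop he0 hea hεt hεrec
  · -- p₁⁴(k₂+1) ≤ 2
    have h1 : ((2427 : ℝ) / 5000) ^ 4 * ((k₂ : ℝ) + 1) ≤ ((2427 : ℝ) / 5000) ^ 4 * ((35 : ℝ) + 1) := mul_le_mul_of_nonneg_left (by linarith) (by positivity)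
    have h2 : ((2427 : ℝ) / 5000) ^ 4 * ((35 : ℝ) + 1) ≤ 2 := by norm_num
    linarith
  · -- p₂⁴(k₃+1) ≤ k₂+1
    have h1 : ((8349 : ℝ) / 10000) ^ 4 * ((k₃ : ℝ) + 1) ≤ ((8349 : ℝ) / 10000) ^ 4 * ((71 : ℝ) + 1) := mul_le_mul_of_nonneg_left (by linarith) (by positivity)
    have h2 : ((8349 : ℝ) / 10000) ^ 4 * ((71 : ℝ) + 1) ≤ (34 : ℝ) + 1 := by norm_num
    linarith
  · -- √2∕(1+p₁) ≤ σ₁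
    rw [div_le_iff₀ (by norm_num)]; linarith [hs99]
  · -- √2∕(1+p₂) ≤ σ₂
    rw [div_le_iff₀ (by norm_num)]; linarith [hs99]
  · -- 2(k₂+1)∕k₃ ≤ E
    rw [div_le_iff₀ hk3pos]; nlinarith [hk2hi', hk3lo']
  · -- 4∕k₂ ≤ B
    exact div_le_div_of_nonneg_left (by norm_num) (by norm_num) hk2lo'
  · -- 4∕k₃ ≤ C
    exact div_le_div_of_nonneg_left (by norm_num) (by norm_num) hk3lo'

/-- **NEAR BAND `36 ≤ k₂ ≤ 37`, `57 ≤ k₃ ≤ 75` (ratio below 2) ⟹ THE END** ((E93c) `flow_nonneg_census_three_ages_two_pairs_near` with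
`s = 14143/20000`, `p₁ = 4789/10000`, `σ₁ = 95631/100000`, `p₂ = 8353/10000`, `σ₂ = 77061/100000`, `E = 4/3`, `B = 1/9`, `C = 4/57`; exact rational certificate, margin `0.0072`). [folklore] -/
theorem joint_near_band_k36_37_57_75 (hmono : ∀ u v : ℕ → ℝ, SeqBox γ u → SeqBox γ v → (∀ j, u j ≤ v j) → B u ≤ B v)
    (hL : ∀ k, 0 ≤ L k) (hb : 0 < b) (hlo : ∀ u, SeqBox γ u → b ≤ B u) (hdom : ∀ u, SeqBox γ u → ∑ k ∈ range K, L k * u k ≤ B u)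
    (hh : SeqBox γ h) (hf : MemFlow B gIR h) (hg : ∀ t, 0 < g t ∧ g t ≤ 1)
    (hgF : ∀ t, 1 ≤ g t * (1 + ∑ k ∈ range K, L k * h (t + k) ^ 3 / 2))
    {k₂ k₃ : ℕ} (hk2lo : 36 ≤ k₂) (hk2hi : k₂ ≤ 37) (hk3lo : 57 ≤ k₃) (hk3hi : k₃ ≤ 75) (hk3K : k₃ < K)
    (hL3 : ∀ j, j < K → j ≠ 1 → j ≠ k₂ → j ≠ k₃ → L j = 0)
    {N : ℕ} {KL : ℕ → ℕ → ℕ → ℝ}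
    (hKL : ∀ k n l, KL k n l = if 0 < k ∧ k < K ∧ l < k then L k * h (n + k) ^ 3 / 2 * ∏ t ∈ Ico (n + 1 + l) (n + k + 1), g t else 0)
    {KA : ℕ → ℕ → ℕ → ℝ} {RA : ℕ → (ℕ → ℝ) → ℕ → ℝ}
    (hRA : ∀ i v m, RA i v m = ∑ l ∈ range K, KA i m l * v (m + 1 + l))
    (hKA : ∀ i m l, KA i m l = KL i m l + KA (i + 1) m l) (hKAtop : ∀ m l, KA K m l = 0)
    {e ε : ℕ → ℝ} (he0 : ∀ m, 0 ≤ e m) (hea : ∀ m, e (m + 1) ≤ e m)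
    (hεt : ∀ m, N < m → ε m = 0) (hεrec : ∀ m, ε m = e m - RA 1 ε m) : ∀ m, 0 ≤ ε m ∧ ε m ≤ e m := by
  have hs99 : Real.sqrt 2 ≤ 99 / 70 := Real.sqrt_le_iff.mpr ⟨by norm_num, by norm_num⟩
  have hk2lo' : (36 : ℝ) ≤ k₂ := by exact_mod_cast hk2lo
  have hk2hi' : (k₂ : ℝ) ≤ 37 := by exact_mod_cast hk2hi
  have hk3lo' : (57 : ℝ) ≤ k₃ := by exact_mod_cast hk3lo
  have hk3hi' : (k₃ : ℝ) ≤ 75 := by exact_mod_cast hk3hi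
  have hk3pos : (0 : ℝ) < k₃ := by exact_mod_cast (show 0 < k₃ by omega)
  refine flow_nonneg_census_three_ages_two_pairs_near hmono hL hb hlo hdom hh hf hg hgF (by omega) (by omega) hk3K hL3
    (p₁ := ((4789 : ℝ) / 10000)) (p₂ := ((8353 : ℝ) / 10000)) (by norm_num) ?_ (by norm_num) ?_
    (s := ((14143 : ℝ) / 20000)) (σ₁ := ((95631 : ℝ) / 100000)) (σ₂ := ((77061 : ℝ) / 100000)) (E := ((4 : ℝ) / 3)) (Bc := ((4 : ℝ) / 36)) (Cc := ((4 : ℝ) / 57))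
    (by linarith [hs99]) (by norm_num) ?_ ?_ ?_ (by norm_num) ?_ ?_ (by norm_num)
    (b₁ := ((3173 : ℝ) / 50000)) (a₂ := ((6229 : ℝ) / 25000)) (ρ₁ := ((643294261 : ℝ) / 3000000000)) (ρ₂ := ((643294261 : ℝ) / 3000000000)) (ρ₃ := ((7196134093 : ℝ) / 40000000000)) (ρ₄ := ((7196134093 : ℝ) / 40000000000))
    (Or.inr (by norm_num)) (by norm_num) (by norm_num) (by norm_num)
    (fun h => absurd h (by norm_num)) (fun h => absurd h (by norm_num)) (fun h => absurd h (by norm_num)) (fun h => absurd h (by norm_num))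
    (fun _ => by norm_num) (fun _ => by norm_num) (fun _ => by norm_num)
    (Or.inl (by norm_num)) (by norm_num) (by norm_num) (by norm_num) (by norm_num)
    hKL hRA hKA hKAtop he0 hea hεt hεrec
  · -- p₁⁴(k₂+1) ≤ 2
    have h1 : ((4789 : ℝ) / 10000) ^ 4 * ((k₂ : ℝ) + 1) ≤ ((4789 : ℝ) / 10000) ^ 4 * ((37 : ℝ) + 1) := mul_le_mul_of_nonneg_left (by linarith) (by positivity)
    have h2 : ((4789 : ℝ) / 10000) ^ 4 * ((37 : ℝ) + 1) ≤ 2 := by norm_num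
    linarith
  · -- p₂⁴(k₃+1) ≤ k₂+1
    have h1 : ((8353 : ℝ) / 10000) ^ 4 * ((k₃ : ℝ) + 1) ≤ ((8353 : ℝ) / 10000) ^ 4 * ((75 : ℝ) + 1) := mul_le_mul_of_nonneg_left (by linarith) (by positivity)
    have h2 : ((8353 : ℝ) / 10000) ^ 4 * ((75 : ℝ) + 1) ≤ (36 : ℝ) + 1 := by norm_num
    linarith
  · -- √2∕(1+p₁) ≤ σ₁
    rw [div_le_iff₀ (by norm_num)]; linarith [hs99]
  · -- √2∕(1+p₂) ≤ σ₂
    rw [div_le_iff₀ (by norm_num)]; linarith [hs99]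
  · -- 2(k₂+1)∕k₃ ≤ E
    rw [div_le_iff₀ hk3pos]; nlinarith [hk2hi', hk3lo']
  · -- 4∕k₂ ≤ B
    exact div_le_div_of_nonneg_left (by norm_num) (by norm_num) hk2lo'
  · -- 4∕k₃ ≤ C
    exact div_le_div_of_nonneg_left (by norm_num) (by norm_num) hk3lo'

/-- **NEAR BAND `38 ≤ k₂ ≤ 39`, `57 ≤ k₃ ≤ 79` (ratio below 2) ⟹ THE END** ((E93c) `flow_nonneg_census_three_ages_two_pairs_near` with
`s = 14143/20000`, `p₁ = 591/1250`, `σ₁ = 24007/25000`, `p₂ = 1671/2000`, `σ₂ = 19263/25000`, `E = 80/57`, `B = 2/19`, `C = 4/57`; exact rational certificate, margin `0.0051`). [folklore] -/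
theorem joint_near_band_k38_39_57_79 (hmono : ∀ u v : ℕ → ℝ, SeqBox γ u → SeqBox γ v → (∀ j, u j ≤ v j) → B u ≤ B v)
    (hL : ∀ k, 0 ≤ L k) (hb : 0 < b) (hlo : ∀ u, SeqBox γ u → b ≤ B u) (hdom : ∀ u, SeqBox γ u → ∑ k ∈ range K, L k * u k ≤ B u)
    (hh : SeqBox γ h) (hf : MemFlow B gIR h) (hg : ∀ t, 0 < g t ∧ g t ≤ 1)
    (hgF : ∀ t, 1 ≤ g t * (1 + ∑ k ∈ range K, L k * h (t + k) ^ 3 / 2))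
    {k₂ k₃ : ℕ} (hk2lo : 38 ≤ k₂) (hk2hi : k₂ ≤ 39) (hk3lo : 57 ≤ k₃) (hk3hi : k₃ ≤ 79) (hk3K : k₃ < K)
    (hL3 : ∀ j, j < K → j ≠ 1 → j ≠ k₂ → j ≠ k₃ → L j = 0)
    {N : ℕ} {KL : ℕ → ℕ → ℕ → ℝ}
    (hKL : ∀ k n l, KL k n l = if 0 < k ∧ k < K ∧ l < k then L k * h (n + k) ^ 3 / 2 * ∏ t ∈ Ico (n + 1 + l) (n + k + 1), g t else 0)
    {KA : ℕ → ℕ → ℕ → ℝ} {RA : ℕ → (ℕ → ℝ) → ℕ → ℝ}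
    (hRA : ∀ i v m, RA i v m = ∑ l ∈ range K, KA i m l * v (m + 1 + l))
    (hKA : ∀ i m l, KA i m l = KL i m l + KA (i + 1) m l) (hKAtop : ∀ m l, KA K m l = 0)
    {e ε : ℕ → ℝ} (he0 : ∀ m, 0 ≤ e m) (hea : ∀ m, e (m + 1) ≤ e m)
    (hεt : ∀ m, N < m → ε m = 0) (hεrec : ∀ m, ε m = e m - RA 1 ε m) : ∀ m, 0 ≤ ε m ∧ ε m ≤ e m := by
  have hs99 : Real.sqrt 2 ≤ 99 / 70 := Real.sqrt_le_iff.mpr ⟨by norm_num, by norm_num⟩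
  have hk2lo' : (38 : ℝ) ≤ k₂ := by exact_mod_cast hk2lo
  have hk2hi' : (k₂ : ℝ) ≤ 39 := by exact_mod_cast hk2hi
  have hk3lo' : (57 : ℝ) ≤ k₃ := by exact_mod_cast hk3lo
  have hk3hi' : (k₃ : ℝ) ≤ 79 := by exact_mod_cast hk3hi
  have hk3pos : (0 : ℝ) < k₃ := by exact_mod_cast (show 0 < k₃ by omega)
  refine flow_nonneg_census_three_ages_two_pairs_near hmono hL hb hlo hdom hh hf hg hgF (by omega) (by omega) hk3K hL3
    (p₁ := ((591 : ℝ) / 1250)) (p₂ := ((1671 : ℝ) / 2000)) (by norm_num) ?_ (by norm_num) ?_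
    (s := ((14143 : ℝ) / 20000)) (σ₁ := ((24007 : ℝ) / 25000)) (σ₂ := ((19263 : ℝ) / 25000)) (E := ((80 : ℝ) / 57)) (Bc := ((4 : ℝ) / 38)) (Cc := ((4 : ℝ) / 57))
    (by linarith [hs99]) (by norm_num) ?_ ?_ ?_ (by norm_num) ?_ ?_ (by norm_num)
    (b₁ := ((6337 : ℝ) / 100000)) (a₂ := ((25313 : ℝ) / 100000)) (ρ₁ := ((24099363607 : ℝ) / 114000000000)) (ρ₂ := ((24099363607 : ℝ) / 114000000000)) (ρ₃ := ((8055482371 : ℝ) / 47500000000)) (ρ₄ := ((8055482371 : ℝ) / 47500000000))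
    (Or.inr (by norm_num)) (by norm_num) (by norm_num) (by norm_num)
    (fun h => absurd h (by norm_num)) (fun h => absurd h (by norm_num)) (fun h => absurd h (by norm_num)) (fun h => absurd h (by norm_num))
    (fun _ => by norm_num) (fun _ => by norm_num) (fun _ => by norm_num)
    (Or.inl (by norm_num)) (by norm_num) (by norm_num) (by norm_num) (by norm_num)
    hKL hRA hKA hKAtop he0 hea hεt hεrec
  · -- p₁⁴(k₂+1) ≤ 2
    have h1 : ((591 : ℝ) / 1250) ^ 4 * ((k₂ : ℝ) + 1) ≤ ((591 : ℝ) / 1250) ^ 4 * ((39 : ℝ) + 1) := mul_le_mul_of_nonneg_left (by linarith) (by positivity)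
    have h2 : ((591 : ℝ) / 1250) ^ 4 * ((39 : ℝ) + 1) ≤ 2 := by norm_num
    linarith
  · -- p₂⁴(k₃+1) ≤ k₂+1
    have h1 : ((1671 : ℝ) / 2000) ^ 4 * ((k₃ : ℝ) + 1) ≤ ((1671 : ℝ) / 2000) ^ 4 * ((79 : ℝ) + 1) := mul_le_mul_of_nonneg_left (by linarith) (by positivity)
    have h2 : ((1671 : ℝ) / 2000) ^ 4 * ((79 : ℝ) + 1) ≤ (38 : ℝ) + 1 := by norm_num
    linarith
  · -- √2∕(1+p₁) ≤ σ₁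
    rw [div_le_iff₀ (by norm_num)]; linarith [hs99]
  · -- √2∕(1+p₂) ≤ σ₂
    rw [div_le_iff₀ (by norm_num)]; linarith [hs99]
  · -- 2(k₂+1)∕k₃ ≤ E
    rw [div_le_iff₀ hk3pos]; nlinarith [hk2hi', hk3lo']
  · -- 4∕k₂ ≤ B
    exact div_le_div_of_nonneg_left (by norm_num) (by norm_num) hk2lo'
  · -- 4∕k₃ ≤ C
    exact div_le_div_of_nonneg_left (by norm_num) (by norm_num) hk3lo'

end Summit.QuantumFields.BalabanUV.Beta.EriceRemainderEnclosureHistoryAutonomyComparisonAgeCompositionTwoPairsBandsF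

end
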